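import Mathlib
import Summits.ValiantsHypothesis.ValiantsHypothesis.Theorems.NewtonTauWeak.Negative.Zonogon
import Summits.ValiantsHypothesis.ValiantsHypothesis.Theorems.NewtonUnitEquationsNewtonTauWeakResidueDesignHull

/-!
# `NewtonUnitEquationsNewtonTauWeakResidueDesignT2` — T2 for torsion (block-popcount residue) designs

Registered stub `stub_residueDesignT2` of line `binomial-normal-form` (crux `NewtonTauWeak`,
stmt-ValiantsHypothesis-5904, lead c5): THEOREM G (`stub_residueDesignHull`) read as a literal instance of the
binomial normal form `T2`, POLYNOMIAL and uniform in the number `K = Π q i` of products.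

Setting.  Dissociated nonzero exponents `d j ∈ ℕ²` (`j : Fin N`; all subset sums distinct), nonzero coefficients
`ρ j`, blocks `B j : Fin s`, moduli `q i ≥ 1` with primitive `q i`-th roots of unity `ζ i`, residues `r i`.  The
*design* is the sum of `K = Π q i` products of `N` binomials
`f = Σ_θ c_θ Π_j (1 − ζ_{B j}^{θ_{B j}} ρ_j X^{d_j})`, `c_θ = Π_i ζ_i^{−θ_i r_i} / q_i`, `θ ∈ Π_i Fin (q i)`.

Proof.
* (`ResidueDesignT2Aux.coeff_design`)  Expanding each product (`prod_one_sub_eq_sum`), the coefficient of `f` at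
  `e` is `Σ_θ Σ_{T : Σ_T d = e} c_θ Π_{j ∈ T} (−ζ_{B j}^{θ_{B j}} ρ_j)`.
* (`ResidueDesignT2Aux.coeff_design_subsetSum`)  At a subset sum `e = Σ_J d` only `T = J` contributes
  (dissociation); regrouping the product by blocks (`prod_neg_pow_mul`: `Π_{j∈J} ζ_{B j}^{θ_{B j}} = Π_i ζ_i^{θ_i n_i}`,
  `n_i = |J ∩ B⁻¹ i|`) the `θ`-sum factors over the blocks (`Fintype.prod_sum`) into the one-variable character sums
  `Σ_{t < q} ζ^{−t r} ζ^{t n} / q = [n ≡ r (mod q)]` (`charSum_eq`, geometric sum at a root of unity), so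
  `coeff_{Σ_J d} f = Π_{j∈J} (−ρ_j) · [∀ i, n_i ≡ r_i (mod q_i)]`.
* (`ResidueDesignT2Aux.support_design`)  Hence `supp f` is EXACTLY the residue level set
  `{Σ_J d : |J ∩ B⁻¹ i| ≡ r_i (q_i) ∀ i}` of THEOREM G, and `stub_residueDesignHull` bounds the vertices of its hull by
  `(4 (N² + N) + 5) (Π q_i)²`.

Everything is folklore (character orthogonality, expansion of binomial products); no named facts, no citations, no
`def`s.
-/

-- Sub = Summit single-conjunct layout: the duplicated namespace component is mandated by the tree.
set_option linter.dupNamespace false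

noncomputable section

open scoped BigOperators
open MvPolynomial
open Summit.ValiantsHypothesis.ValiantsHypothesis.Theorems.NewtonTauWeak.Negative (vert)

namespace Summit.ValiantsHypothesis.ValiantsHypothesis.Theorems.NewtonUnitEquationsNewtonTauWeak

namespace ResidueDesignT2Aux

/-- **Character orthogonality.**  For a primitive `q`-th root of unity `ζ` (`q ≥ 1`) and naturals `n r`,
`Σ_{t < q} ζ^{−t r} / q · ζ^{t n} = [n ≡ r (mod q)]`: the summand is `η^t / q` with `η = ζ^n ζ^{−r}`, which is `1`
iff `ζ^n = ζ^r` iff `n ≡ r (mod q)`, and otherwise `η ≠ 1`, `η^q = 1`, so the geometric sum vanishes. [folklore] -/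
theorem charSum_eq (q : ℕ) (hq : 1 ≤ q) (ζ : ℂ) (hζ : IsPrimitiveRoot ζ q) (n r : ℕ) :
    ∑ t : Fin q, ζ⁻¹ ^ ((t : ℕ) * r) / (q : ℂ) * ζ ^ ((t : ℕ) * n) =
      if n % q = r % q then 1 else 0 := by
  have hq0 : q ≠ 0 := by omega
  have hqC : (q : ℂ) ≠ 0 := Nat.cast_ne_zero.mpr hq0
  have hζ0 : ζ ≠ 0 := hζ.ne_zero hq0
  have hiff : ζ ^ n = ζ ^ r ↔ n % q = r % q := by
    have h := (hζ.isOfFinOrder hq0).pow_inj_mod (n := n) (m := r)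
    rwa [← hζ.eq_orderOf] at h
  have hsummand : ∀ t : ℕ, ζ⁻¹ ^ (t * r) / (q : ℂ) * ζ ^ (t * n) = (ζ ^ n * ζ⁻¹ ^ r) ^ t / q := by
    intro t
    rw [mul_pow, ← pow_mul, ← pow_mul, mul_comm n t, mul_comm r t]
    ring
  simp_rw [hsummand]
  rw [Fin.sum_univ_eq_sum_range (fun t => (ζ ^ n * ζ⁻¹ ^ r) ^ t / (q : ℂ)) q, ← Finset.sum_div]
  split_ifs with h
  · have hη : ζ ^ n * ζ⁻¹ ^ r = 1 := by
      rw [hiff.mpr h, ← mul_pow, mul_inv_cancel₀ hζ0, one_pow]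
    rw [hη]
    simp only [one_pow, Finset.sum_const, Finset.card_range, nsmul_eq_mul, mul_one]
    exact div_self hqC
  · have hη : ζ ^ n * ζ⁻¹ ^ r ≠ 1 := by
      intro h1
      apply h
      rw [← hiff]
      calc ζ ^ n = ζ ^ n * ζ⁻¹ ^ r * ζ ^ r := by
            rw [mul_assoc, ← mul_pow, inv_mul_cancel₀ hζ0, one_pow, mul_one]
        _ = ζ ^ r := by rw [h1, one_mul]
    have hηq : (ζ ^ n * ζ⁻¹ ^ r) ^ q = 1 := by
      rw [mul_pow, ← pow_mul, ← pow_mul, mul_comm n q, mul_comm r q, pow_mul, pow_mul, hζ.pow_eq_one,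
        inv_pow, hζ.pow_eq_one, inv_one, one_pow, one_pow, mul_one]
    rw [geom_sum_eq hη, hηq, sub_self, zero_div, zero_div]

/-- Expansion of a product of binomials: `Π_j (1 - a_j X^{d_j}) = Σ_T (Π_{j ∈ T} (-a_j)) X^{Σ_T d_j}`. [folklore] -/
theorem prod_one_sub_eq_sum {N : ℕ} (a : Fin N → ℂ) (d : Fin N → (Fin 2 →₀ ℕ)) :
    (∏ j, (1 - C (a j) * monomial (d j) 1) : MvPolynomial (Fin 2) ℂ) =
      ∑ T : Finset (Fin N), monomial (∑ j ∈ T, d j) (∏ j ∈ T, -a j) := by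
  have h : ∀ j, (1 - C (a j) * monomial (d j) 1 : MvPolynomial (Fin 2) ℂ) = 1 + monomial (d j) (-a j) := by
    intro j
    rw [C_mul_monomial, mul_one, sub_eq_add_neg, ← map_neg]
  simp_rw [h]
  rw [Finset.prod_one_add, Finset.powerset_univ]
  exact Finset.sum_congr rfl fun T _ => (monomial_sum_prod T d fun j => -a j).symm

/-- Block regrouping of the coefficient of one expanded product: `Π_{j ∈ J} (−ζ_{B j}^{θ_{B j}} ρ_j) =
Π_{j ∈ J} (−ρ_j) · Π_i ζ_i^{θ_i · |J ∩ B⁻¹ i|}` (`Finset.prod_fiberwise'`). [folklore] -/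
theorem prod_neg_pow_mul {N s : ℕ} (B : Fin N → Fin s) (q : Fin s → ℕ) (ζ : Fin s → ℂ) (ρ : Fin N → ℂ)
    (θ : (i : Fin s) → Fin (q i)) (J : Finset (Fin N)) :
    ∏ j ∈ J, -((ζ (B j)) ^ ((θ (B j) : ℕ)) * ρ j) =
      (∏ j ∈ J, -ρ j) * ∏ i, (ζ i) ^ ((θ i : ℕ) * (J.filter fun j => B j = i).card) := by
  have h : ∀ j, -((ζ (B j)) ^ ((θ (B j) : ℕ)) * ρ j) = (-ρ j) * (ζ (B j)) ^ ((θ (B j) : ℕ)) := fun j => by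
    ring
  simp_rw [h, pow_mul]
  rw [Finset.prod_mul_distrib, ← Finset.prod_fiberwise' J B fun i => ζ i ^ (θ i : ℕ)]
  simp_rw [Finset.prod_const]

/-- Coefficients of the design, raw form: expanding every product,
`coeff_e f = Σ_θ Σ_{T : Σ_T d = e} c_θ Π_{j ∈ T} (−ζ_{B j}^{θ_{B j}} ρ_j)`. [folklore] -/
theorem coeff_design {N s : ℕ} (B : Fin N → Fin s) (q r : Fin s → ℕ) (ζ : Fin s → ℂ) (ρ : Fin N → ℂ)
    (d : Fin N → (Fin 2 →₀ ℕ)) (e : Fin 2 →₀ ℕ) :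
    coeff e (∑ θ : ((i : Fin s) → Fin (q i)),
        C (∏ i, ((ζ i)⁻¹) ^ ((θ i : ℕ) * r i) / (q i : ℂ)) *
          ∏ j, (1 - C ((ζ (B j)) ^ ((θ (B j) : ℕ)) * ρ j) * monomial (d j) 1)) =
      ∑ θ : ((i : Fin s) → Fin (q i)), ∑ T : Finset (Fin N),
        if ∑ j ∈ T, d j = e then
          (∏ i, ((ζ i)⁻¹) ^ ((θ i : ℕ) * r i) / (q i : ℂ)) * ∏ j ∈ T, -((ζ (B j)) ^ ((θ (B j) : ℕ)) * ρ j)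
        else 0 := by
  rw [coeff_sum]
  refine Finset.sum_congr rfl fun θ _ => ?_
  rw [prod_one_sub_eq_sum, Finset.mul_sum, coeff_sum]
  refine Finset.sum_congr rfl fun T _ => ?_
  rw [C_mul_monomial, coeff_monomial]

/-- **Coefficient formula on a dissociated frame.**  At the subset sum `Σ_J d` only `T = J` contributes; after
block regrouping the `θ`-sum factors over blocks into character sums, giving
`coeff_{Σ_J d} f = Π_{j ∈ J} (−ρ_j) · [∀ i, |J ∩ B⁻¹ i| ≡ r_i (mod q_i)]`. [folklore] -/
theorem coeff_design_subsetSum {N s : ℕ} (B : Fin N → Fin s) (q r : Fin s → ℕ) (hq : ∀ i, 1 ≤ q i)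
    (ζ : Fin s → ℂ) (hζ : ∀ i, IsPrimitiveRoot (ζ i) (q i)) (ρ : Fin N → ℂ)
    (d : Fin N → (Fin 2 →₀ ℕ))
    (hdis : ∀ J J' : Finset (Fin N), ∑ j ∈ J, d j = ∑ j ∈ J', d j → J = J') (J : Finset (Fin N)) :
    coeff (∑ j ∈ J, d j) (∑ θ : ((i : Fin s) → Fin (q i)),
        C (∏ i, ((ζ i)⁻¹) ^ ((θ i : ℕ) * r i) / (q i : ℂ)) *
          ∏ j, (1 - C ((ζ (B j)) ^ ((θ (B j) : ℕ)) * ρ j) * monomial (d j) 1)) =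
      (∏ j ∈ J, -ρ j) *
        if ∀ i, (J.filter fun j => B j = i).card % q i = r i % q i then 1 else 0 := by
  rw [coeff_design]
  calc (∑ θ : ((i : Fin s) → Fin (q i)), ∑ T : Finset (Fin N),
        if ∑ j ∈ T, d j = ∑ j ∈ J, d j then
          (∏ i, ((ζ i)⁻¹) ^ ((θ i : ℕ) * r i) / (q i : ℂ)) * ∏ j ∈ T, -((ζ (B j)) ^ ((θ (B j) : ℕ)) * ρ j)
        else 0)
      = ∑ θ : ((i : Fin s) → Fin (q i)),
          (∏ i, ((ζ i)⁻¹) ^ ((θ i : ℕ) * r i) / (q i : ℂ)) *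
            ((∏ j ∈ J, -ρ j) * ∏ i, (ζ i) ^ ((θ i : ℕ) * (J.filter fun j => B j = i).card)) := by
        refine Finset.sum_congr rfl fun θ _ => ?_
        rw [Finset.sum_eq_single J (fun T _ hTJ => if_neg fun h => hTJ (hdis T J h))
          (fun h => absurd (Finset.mem_univ J) h), if_pos rfl, prod_neg_pow_mul]
    _ = (∏ j ∈ J, -ρ j) * ∑ θ : ((i : Fin s) → Fin (q i)),
          ∏ i, ((ζ i)⁻¹ ^ (((θ i : Fin (q i)) : ℕ) * r i) / (q i : ℂ) *
            (ζ i) ^ (((θ i : Fin (q i)) : ℕ) * (J.filter fun j => B j = i).card)) := by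
        rw [Finset.mul_sum]
        refine Finset.sum_congr rfl fun θ _ => ?_
        rw [mul_left_comm, Finset.prod_mul_distrib]
    _ = (∏ j ∈ J, -ρ j) * ∏ i, ∑ t : Fin (q i),
          (ζ i)⁻¹ ^ ((t : ℕ) * r i) / (q i : ℂ) * (ζ i) ^ ((t : ℕ) * (J.filter fun j => B j = i).card) := by
        rw [Fintype.prod_sum fun i (t : Fin (q i)) =>
          (ζ i)⁻¹ ^ ((t : ℕ) * r i) / (q i : ℂ) * (ζ i) ^ ((t : ℕ) * (J.filter fun j => B j = i).card)]
    _ = (∏ j ∈ J, -ρ j) * ∏ i, (if (J.filter fun j => B j = i).card % q i = r i % q i then (1 : ℂ) else 0) := by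
        congr 1
        exact Finset.prod_congr rfl fun i _ => charSum_eq (q i) (hq i) (ζ i) (hζ i) _ (r i)
    _ = (∏ j ∈ J, -ρ j) *
          if ∀ i, (J.filter fun j => B j = i).card % q i = r i % q i then 1 else 0 := by
        -- the two `Decidable (∀ i, _)` instances (`Nat.decidableForallFin` of the statement and
        -- `Fintype.decidableForallFintype` of `Fintype.prod_boole`) agree after case splitting
        rw [Fintype.prod_boole]
        split_ifs <;> rfl

/-- **Support of the design** = the residue level set `{Σ_J d : ∀ i, |J ∩ B⁻¹ i| ≡ r_i (mod q_i)}`: off the subset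
sums every raw summand vanishes, and at a subset sum the coefficient is `Π_{j∈J} (−ρ_j) ≠ 0` times the
admissibility indicator. [folklore] -/
theorem support_design {N s : ℕ} (B : Fin N → Fin s) (q r : Fin s → ℕ) (hq : ∀ i, 1 ≤ q i)
    (ζ : Fin s → ℂ) (hζ : ∀ i, IsPrimitiveRoot (ζ i) (q i)) (ρ : Fin N → ℂ) (hρ : ∀ j, ρ j ≠ 0)
    (d : Fin N → (Fin 2 →₀ ℕ))
    (hdis : ∀ J J' : Finset (Fin N), ∑ j ∈ J, d j = ∑ j ∈ J', d j → J = J') :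
    (∑ θ : ((i : Fin s) → Fin (q i)),
        C (∏ i, ((ζ i)⁻¹) ^ ((θ i : ℕ) * r i) / (q i : ℂ)) *
          ∏ j, (1 - C ((ζ (B j)) ^ ((θ (B j) : ℕ)) * ρ j) * monomial (d j) 1)).support =
      ((Finset.univ.filter fun J : Finset (Fin N) =>
          ∀ i, (J.filter fun j => B j = i).card % q i = r i % q i).image
        fun J => ∑ j ∈ J, d j : Finset (Fin 2 →₀ ℕ)) := by
  have hprod : ∀ J : Finset (Fin N), ∏ j ∈ J, -ρ j ≠ 0 := fun J =>
    Finset.prod_ne_zero_iff.mpr fun j _ => neg_ne_zero.mpr (hρ j)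
  ext e
  rw [mem_support_iff, Finset.mem_image]
  constructor
  · intro he
    by_cases hex : ∃ J : Finset (Fin N), ∑ j ∈ J, d j = e
    · obtain ⟨J, rfl⟩ := hex
      rw [coeff_design_subsetSum B q r hq ζ hζ ρ d hdis J] at he
      refine ⟨J, Finset.mem_filter.mpr ⟨Finset.mem_univ J, ?_⟩, rfl⟩
      by_contra hJ
      exact he (by rw [if_neg hJ, mul_zero])
    · refine absurd ?_ he
      rw [coeff_design]
      refine Finset.sum_eq_zero fun θ _ => Finset.sum_eq_zero fun T _ => if_neg fun hT => hex ⟨T, hT⟩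
  · rintro ⟨J, hJ, rfl⟩
    rw [coeff_design_subsetSum B q r hq ζ hζ ρ d hdis J, if_pos (Finset.mem_filter.mp hJ).2, mul_one]
    exact hprod J

end ResidueDesignT2Aux

/-- **T2 for torsion (block-popcount residue) designs, POLYNOMIAL and uniform in the number `K = Π q_i` of
products.**  On a dissociated exponent list with nonzero exponents and coefficients, the design
`f = Σ_θ c_θ Π_j (1 − ζ_{B j}^{θ_{B j}} ρ_j X^{d_j})`, `c_θ = Π_i ζ_i^{−θ_i r_i} / q_i` (`ζ_i` a primitive `q_i`-th
root of unity), has coefficient `[∀ i, |J ∩ B⁻¹ i| ≡ r_i (q_i)] · Π_{j∈J} (−ρ_j)` at `Σ_{j∈J} d_j` (character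
orthogonality), so `supp f` is EXACTLY the residue level set of THEOREM G (`stub_residueDesignHull`) and
`vert f ≤ (4 (N² + N) + 5) (Π q_i)²`. [folklore] -/
theorem stub_residueDesignT2 (N s : ℕ) (B : Fin N → Fin s) (q r : Fin s → ℕ) (hq : ∀ i, 1 ≤ q i)
    (ζ : Fin s → ℂ) (hζ : ∀ i, IsPrimitiveRoot (ζ i) (q i)) (ρ : Fin N → ℂ) (hρ : ∀ j, ρ j ≠ 0)
    (d : Fin N → (Fin 2 →₀ ℕ)) (hd : ∀ j, d j ≠ 0)
    (hdis : ∀ J J' : Finset (Fin N), ∑ j ∈ J, d j = ∑ j ∈ J', d j → J = J') :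
    vert (∑ θ : ((i : Fin s) → Fin (q i)),
        C (∏ i, ((ζ i)⁻¹) ^ ((θ i : ℕ) * r i) / (q i : ℂ)) *
          ∏ j, (1 - C ((ζ (B j)) ^ ((θ (B j) : ℕ)) * ρ j) * monomial (d j) 1)) ≤
      (4 * (N * N + N) + 5) * (∏ i, q i) ^ 2 := by
  unfold vert
  rw [ResidueDesignT2Aux.support_design B q r hq ζ hζ ρ hρ d hdis]
  exact stub_residueDesignHull N s B q r hq d hd

end Summit.ValiantsHypothesis.ValiantsHypothesis.Theorems.NewtonUnitEquationsNewtonTauWeak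

end
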